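import Summits.KontsevichZagierPeriods.KontsevichZagierPeriods.Theorems.HurwitzMicroSectorsNormalFormPrincipleBoxUnicoordReductionK2
import Summits.KontsevichZagierPeriods.KontsevichZagierPeriods.Theorems.HurwitzMicroSectorsNormalFormPrincipleDimOneAssembly

/-!
# `NormalFormPrinciple` (stmt-KontsevichZagierPeriods-3869), line `SketchIdeator1` —
# the leaf `stub_boxRigidity` on the all-dimension UNICOORDINATE family, unconditionally

Pure proof file (lead seat c4; `--supports` the crux). The registered leaf `stub_boxRigidity`
(Conjecture 1 frozen to box-rational representations `[(0,1)ᵐ, p/q]`) is a theorem on the family of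
ALL dimensions `m, m'` whose denominators see one coordinate only: integrands `p(x)/q(xᵢ)` with
`p ∈ ℚ[x₀,…,x_{m−1}]`, `q ∈ ℚ[X]` without zeros on `[0,1]` — in particular all POLYNOMIAL integrands
(`boxUnicoord_rigidity_poly`, a registered sub-goal of the crux, verbatim). Composition of two landed
engines: siege k2's reduction `Unicoord.boxUnicoord_reduce` (integrating out the coordinates the
denominator does not see by Newton–Leibniz moves, then a coordinate permutation: `[(0,1)ᵐ, p/q(xᵢ)]
≡ [(0,1), p₁/q]`) and this seat's Conjecture 1 in dimension `≤ 1` (`Dlog.kzConjecture_of_dim_le_one`,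
Baker). The mixed pairs — a unicoordinate box against ANY rational representation of dimension `≤ 1`
— are covered as well (`boxUnicoord_equivalent_of_dim_le_one`).

Sources: M. Kontsevich, D. Zagier, *Periods* (2001), §1.2 Conjecture 1; J. Ayoub, EMS Newsl. 91
(2014), Def. 10 (Stokes relation); A. Baker, *Transcendental Number Theory* (1975), Thm. 2.1.
No definitions are introduced.
-/

noncomputable section

open MeasureTheory Set
open scoped Polynomial
open Literature.NumberTheory.Transcendental Literature.NumberTheory.Transcendental.KZ
open Literature.ModelTheory.ExponentialFields (IsSemialgebraic)

namespace Summit.KontsevichZagierPeriods.HurwitzMicroSectors.NormalFormPrinciple.PiBox.Unicoord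

open Summit.KontsevichZagierPeriods.HurwitzMicroSectors.NormalFormPrinciple.PiBox.Dlog
  (kzConjecture_of_dim_le_one mem_relations_of_eval_eq_zero_of_dim_le_one)

/-! ## Dimension-one representations with `ℚ`-rational integrands have KZ's rational shape -/

/-- A representation in dimension one whose integrand is `p(x₀)/q(x₀)` on its domain
(`p, q ∈ ℚ[X]`, `q ≠ 0` there) has KZ's rational shape `IsRational` (read `p`, `q` as polynomials in
the variable `x₀`). [cite: KontsevichZagier2001, §1.1] -/
theorem isRational_of_aeval_div (N : IntegralRep 1) (p q : ℚ[X])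
    (hq : ∀ x ∈ N.domain, (Polynomial.aeval (x 0) q : ℝ) ≠ 0)
    (hNi : EqOn N.integrand (fun x => (Polynomial.aeval (x 0) p : ℝ) / Polynomial.aeval (x 0) q)
      N.domain) : N.IsRational := by
  refine ⟨p.toMvPolynomial 0, q.toMvPolynomial 0, fun x hx => ?_, fun x hx => ?_⟩
  · rw [MvPolynomial.aeval_toMvPolynomial]; exact hq x hx
  · rw [hNi hx]
    simp only [MvPolynomial.aeval_toMvPolynomial]

/-! ## Unicoordinate and polynomial box representations are equivalent to rational representations of dimension `≤ 1` -/

/-- **A unicoordinate box-rational representation is KZ-equivalent to a rational representation of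
dimension one** (`Unicoord.boxUnicoord_reduce`, read through `isRational_of_aeval_div`).
[cite: KontsevichZagier2001, §1.2] -/
theorem exists_rational_dim_one_of_unicoord {m : ℕ} (i : Fin m) (p : MvPolynomial (Fin m) ℚ)
    (q : ℚ[X]) (hq : ∀ t ∈ Set.Icc (0:ℝ) 1, (Polynomial.aeval t q : ℝ) ≠ 0) (N : IntegralRep m)
    (hNd : N.domain = {x | ∀ i, x i ∈ Set.Ioo (0:ℝ) 1})
    (hNi : EqOn N.integrand (fun x => (MvPolynomial.aeval x p : ℝ) / Polynomial.aeval (x i) q) N.domain) :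
    ∃ r : IntegralRep 1, r.IsRational ∧ Equivalent N r := by
  obtain ⟨p₁, N₁, hN₁d, hN₁i, hrel⟩ := boxUnicoord_reduce i p q hq N hNd hNi
  refine ⟨N₁, isRational_of_aeval_div N₁ p₁ q (fun x hx => hq (x 0) ?_) hN₁i, hrel⟩
  rw [hN₁d] at hx
  exact Set.Ioo_subset_Icc_self hx

/-- **A box representation with a POLYNOMIAL integrand is KZ-equivalent to a rational representation
of dimension `≤ 1`**: in dimension `0` it is itself a rational point, in dimension `m ≥ 1` it is
unicoordinate with denominator `1`. [cite: KontsevichZagier2001, §1.2] -/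
theorem exists_rational_dim_le_one_of_poly {m : ℕ} (N : IntegralRep m)
    (hNd : N.domain = {x | ∀ i, x i ∈ Set.Ioo (0:ℝ) 1}) (p : MvPolynomial (Fin m) ℚ)
    (hNi : EqOn N.integrand (fun x => (MvPolynomial.aeval x p : ℝ)) N.domain) :
    ∃ (n : ℕ) (r : IntegralRep n), n ≤ 1 ∧ r.IsRational ∧ Equivalent N r := by
  cases m with
  | zero =>
    refine ⟨0, N, zero_le_one, ⟨p, 1, fun x _ => by simp, fun x hx => ?_⟩, Equivalent.refl N⟩
    rw [hNi hx]
    simp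
  | succ k =>
    obtain ⟨r, hr, hNr⟩ := exists_rational_dim_one_of_unicoord (0 : Fin (k + 1)) p 1
      (fun t _ => by simp) N hNd (fun x hx => by rw [hNi hx]; simp)
    exact ⟨1, r, le_rfl, hr, hNr⟩

/-- **Gluing through dimension `≤ 1`.** If `N ≡ r` and `N' ≡ r'` modulo KZ relations with `r`, `r'`
of KZ's rational shape and dimensions `≤ 1`, and `N`, `N'` have equal values, then `N ≡ N'`
(soundness transports the values; `kzConjecture_of_dim_le_one` connects `r` and `r'`).
[cite: KontsevichZagier2001, §1.2 Conjecture 1] -/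
theorem equivalent_of_equivalent_rational_dim_le_one {m m' n n' : ℕ} {N : IntegralRep m}
    {N' : IntegralRep m'} {r : IntegralRep n} {r' : IntegralRep n'} (hn : n ≤ 1) (hn' : n' ≤ 1)
    (hr : r.IsRational) (hr' : r'.IsRational) (hNr : Equivalent N r) (hN'r' : Equivalent N' r')
    (hv : N.value = N'.value) : Equivalent N N' := by
  have hvr : r.value = r'.value := by
    rw [← Equivalent.value_eq_holds hNr, ← Equivalent.value_eq_holds hN'r', hv]
  exact (hNr.trans (kzConjecture_of_dim_le_one hn hn' r r' hr hr' hvr)).trans hN'r'.symm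

/-! ## Box rigidity on the unicoordinate family, all dimensions -/

/-- **`stub_boxRigidity` on the unicoordinate family (all dimensions), unconditionally.** Two
representations on open unit boxes `(0,1)ᵐ`, `(0,1)ᵐ'` with integrands `p(x)/q(xᵢ)`, `p'(x)/q'(x_{i'})`
(`p, p'` rational polynomials in all variables, `q, q' ∈ ℚ[X]` without zeros on `[0,1]`, each read in a
single coordinate) and equal values are KZ-equivalent. Values: `ℚ + Σ ℚ̄ log ℚ̄ + ℚ̄π`-type numbers such as
`∫∫ x dxdy/(1+y²) = π/8`. Registered sub-goal `boxUnicoord_rigidity_of_open1` follows a fortiori (its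
hypothesis `hV` is now a theorem for every `q`). [cite: KontsevichZagier2001, §1.2 Conjecture 1] -/
theorem boxUnicoord_equivalent_of_value_eq {m m' : ℕ} (N : IntegralRep m) (N' : IntegralRep m')
    (hNd : N.domain = {x | ∀ i, x i ∈ Set.Ioo (0:ℝ) 1}) (i : Fin m) (p : MvPolynomial (Fin m) ℚ)
    (q : ℚ[X]) (hq : ∀ t ∈ Set.Icc (0:ℝ) 1, (Polynomial.aeval t q : ℝ) ≠ 0)
    (hNi : EqOn N.integrand (fun x => (MvPolynomial.aeval x p : ℝ) / Polynomial.aeval (x i) q) N.domain)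
    (hN'd : N'.domain = {x | ∀ i, x i ∈ Set.Ioo (0:ℝ) 1}) (i' : Fin m') (p' : MvPolynomial (Fin m') ℚ)
    (q' : ℚ[X]) (hq' : ∀ t ∈ Set.Icc (0:ℝ) 1, (Polynomial.aeval t q' : ℝ) ≠ 0)
    (hN'i : EqOn N'.integrand (fun x => (MvPolynomial.aeval x p' : ℝ) / Polynomial.aeval (x i') q')
      N'.domain)
    (hv : N.value = N'.value) : Equivalent N N' := by
  obtain ⟨r, hr, hNr⟩ := exists_rational_dim_one_of_unicoord i p q hq N hNd hNi
  obtain ⟨r', hr', hN'r'⟩ := exists_rational_dim_one_of_unicoord i' p' q' hq' N' hN'd hN'i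
  exact equivalent_of_equivalent_rational_dim_le_one le_rfl le_rfl hr hr' hNr hN'r' hv

/-- **A unicoordinate box against any rational representation of dimension `≤ 1`.** A representation
on `(0,1)ᵐ` with integrand `p(x)/q(xᵢ)` as above and a representation of KZ's rational shape of
dimension `n ≤ 1` (any `ℚ`-semialgebraic domain in `ℝ`, or a constant) with the same value are
KZ-equivalent — the mixed pairs `(m, ≤ 1)` of the leaf. [cite: KontsevichZagier2001, §1.2 Conjecture 1] -/
theorem boxUnicoord_equivalent_of_dim_le_one {m n : ℕ} (N : IntegralRep m) (r' : IntegralRep n)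
    (hNd : N.domain = {x | ∀ i, x i ∈ Set.Ioo (0:ℝ) 1}) (i : Fin m) (p : MvPolynomial (Fin m) ℚ)
    (q : ℚ[X]) (hq : ∀ t ∈ Set.Icc (0:ℝ) 1, (Polynomial.aeval t q : ℝ) ≠ 0)
    (hNi : EqOn N.integrand (fun x => (MvPolynomial.aeval x p : ℝ) / Polynomial.aeval (x i) q) N.domain)
    (hn : n ≤ 1) (hr' : r'.IsRational) (hv : N.value = r'.value) : Equivalent N r' := by
  obtain ⟨r, hr, hNr⟩ := exists_rational_dim_one_of_unicoord i p q hq N hNd hNi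
  exact equivalent_of_equivalent_rational_dim_le_one le_rfl hn hr hr' hNr (Equivalent.refl r') hv

/-- **`stub_boxRigidity` for POLYNOMIAL integrands, all dimensions (registered sub-goal
`boxUnicoord_rigidity_poly` of stmt-KontsevichZagierPeriods-3869, verbatim).** Two representations on
open unit boxes `(0,1)ᵐ`, `(0,1)ᵐ'` whose integrands are rational polynomials and whose values (rational
numbers) agree are KZ-equivalent: both are equivalent to rational representations of dimension `≤ 1`
(`exists_rational_dim_le_one_of_poly`), which Conjecture 1 in dimension `≤ 1` connects.
[cite: KontsevichZagier2001, §1.2 Conjecture 1] -/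
theorem boxUnicoord_rigidity_poly {m m' : ℕ} (N : IntegralRep m) (N' : IntegralRep m')
    (hNd : N.domain = {x | ∀ i, x i ∈ Set.Ioo (0:ℝ) 1}) (p : MvPolynomial (Fin m) ℚ)
    (hNi : EqOn N.integrand (fun x => (MvPolynomial.aeval x p : ℝ)) N.domain)
    (hN'd : N'.domain = {x | ∀ i, x i ∈ Set.Ioo (0:ℝ) 1}) (p' : MvPolynomial (Fin m') ℚ)
    (hN'i : EqOn N'.integrand (fun x => (MvPolynomial.aeval x p' : ℝ)) N'.domain)
    (hv : N.value = N'.value) : Equivalent N N' := by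
  obtain ⟨n, r, hn, hr, hNr⟩ := exists_rational_dim_le_one_of_poly N hNd p hNi
  obtain ⟨n', r', hn', hr', hN'r'⟩ := exists_rational_dim_le_one_of_poly N' hN'd p' hN'i
  exact equivalent_of_equivalent_rational_dim_le_one hn hn' hr hr' hNr hN'r' hv

/-- **A polynomial box against any rational representation of dimension `≤ 1`** (e.g.
`[(0,1)³, 6xyz] ≡ [(1,2), 3/(2x²)]`, both of value `3/4`).
[cite: KontsevichZagier2001, §1.2 Conjecture 1] -/
theorem boxPoly_equivalent_of_dim_le_one {m n : ℕ} (N : IntegralRep m) (r' : IntegralRep n)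
    (hNd : N.domain = {x | ∀ i, x i ∈ Set.Ioo (0:ℝ) 1}) (p : MvPolynomial (Fin m) ℚ)
    (hNi : EqOn N.integrand (fun x => (MvPolynomial.aeval x p : ℝ)) N.domain)
    (hn : n ≤ 1) (hr' : r'.IsRational) (hv : N.value = r'.value) : Equivalent N r' := by
  obtain ⟨k, r, hk, hr, hNr⟩ := exists_rational_dim_le_one_of_poly N hNd p hNi
  exact equivalent_of_equivalent_rational_dim_le_one hk hn hr hr' hNr (Equivalent.refl r') hv

/-! ## Kernel form on the unicoordinate family -/

/-- **Every element of the subgroup generated by the unicoordinate box-rational representations and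
the rational representations of dimension `≤ 1` is congruent, modulo KZ relations, to an element of
the subgroup generated by the latter alone** (`exists_rational_dim_one_of_unicoord`, generator by
generator). [cite: KontsevichZagier2001, §1.2] -/
theorem exists_sub_mem_relations_of_unicoord {c : FormalRep}
    (hc : c ∈ AddSubgroup.closure
      ({y : FormalRep | ∃ (m : ℕ) (i : Fin m) (p : MvPolynomial (Fin m) ℚ) (q : ℚ[X]) (N : IntegralRep m),
          (∀ t ∈ Set.Icc (0:ℝ) 1, (Polynomial.aeval t q : ℝ) ≠ 0) ∧
          N.domain = {x | ∀ i, x i ∈ Set.Ioo (0:ℝ) 1} ∧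
          EqOn N.integrand (fun x => (MvPolynomial.aeval x p : ℝ) / Polynomial.aeval (x i) q) N.domain ∧
          y = of N} ∪
       {y : FormalRep | ∃ (m : ℕ) (N : IntegralRep m), m ≤ 1 ∧ N.IsRational ∧ y = of N})) :
    ∃ c' ∈ AddSubgroup.closure
      {y : FormalRep | ∃ (m : ℕ) (N : IntegralRep m), m ≤ 1 ∧ N.IsRational ∧ y = of N},
      c - c' ∈ relations := by
  induction hc using AddSubgroup.closure_induction with
  | mem y hy =>
    rcases hy with hy | hy
    · obtain ⟨m, i, p, q, N, hq, hNd, hNi, rfl⟩ := hy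
      obtain ⟨r, hr, hNr⟩ := exists_rational_dim_one_of_unicoord i p q hq N hNd hNi
      exact ⟨of r, AddSubgroup.subset_closure ⟨1, r, le_rfl, hr, rfl⟩, hNr⟩
    · exact ⟨y, AddSubgroup.subset_closure hy, by rw [sub_self]; exact relations.zero_mem⟩
  | zero => exact ⟨0, AddSubgroup.zero_mem _, by rw [sub_self]; exact relations.zero_mem⟩
  | add y z _ _ ihy ihz =>
    obtain ⟨y', hy', hyy'⟩ := ihy
    obtain ⟨z', hz', hzz'⟩ := ihz
    refine ⟨y' + z', AddSubgroup.add_mem _ hy' hz', ?_⟩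
    have e : y + z - (y' + z') = (y - y') + (z - z') := by abel
    rw [e]
    exact relations.add_mem hyy' hzz'
  | neg y _ ih =>
    obtain ⟨y', hy', hyy'⟩ := ih
    refine ⟨-y', AddSubgroup.neg_mem _ hy', ?_⟩
    have e : -y - -y' = -(y - y') := by abel
    rw [e]
    exact relations.neg_mem hyy'

/-- **Conjecture 1, kernel form, on the subgroup generated by the unicoordinate box-rational
representations (all dimensions) and the rational representations of dimension `≤ 1`.** A formal
`ℤ`-combination of such representations with value `0` is a Kontsevich–Zagier relation: replace every
unicoordinate box by an equivalent rational representation of dimension one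
(`exists_sub_mem_relations_of_unicoord`) and apply the kernel theorem in dimension `≤ 1`
(`Dlog.mem_relations_of_eval_eq_zero_of_dim_le_one`). This is `KZ.PiLocalKernel` with exponent `0` on
that subgroup. [cite: KontsevichZagier2001, §1.2 Conjecture 1] -/
theorem mem_relations_of_eval_eq_zero_of_unicoord {c : FormalRep}
    (hc : c ∈ AddSubgroup.closure
      ({y : FormalRep | ∃ (m : ℕ) (i : Fin m) (p : MvPolynomial (Fin m) ℚ) (q : ℚ[X]) (N : IntegralRep m),
          (∀ t ∈ Set.Icc (0:ℝ) 1, (Polynomial.aeval t q : ℝ) ≠ 0) ∧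
          N.domain = {x | ∀ i, x i ∈ Set.Ioo (0:ℝ) 1} ∧
          EqOn N.integrand (fun x => (MvPolynomial.aeval x p : ℝ) / Polynomial.aeval (x i) q) N.domain ∧
          y = of N} ∪
       {y : FormalRep | ∃ (m : ℕ) (N : IntegralRep m), m ≤ 1 ∧ N.IsRational ∧ y = of N}))
    (hv : eval c = 0) : c ∈ relations := by
  obtain ⟨c', hc', hcc'⟩ := exists_sub_mem_relations_of_unicoord hc
  have hv' : eval c' = 0 := by
    have h := relations_le_ker_eval_holds hcc'
    rw [AddMonoidHom.mem_ker, map_sub, hv, zero_sub, neg_eq_zero] at h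
    exact h
  have h' : c' ∈ relations := mem_relations_of_eval_eq_zero_of_dim_le_one hc' hv'
  have e : c = (c - c') + c' := by abel
  rw [e]
  exact relations.add_mem hcc' h'

end Summit.KontsevichZagierPeriods.HurwitzMicroSectors.NormalFormPrinciple.PiBox.Unicoord
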